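import Summits.AtomisticToContinuum.HydrodynamicLimit.Theorems.JParityClosureLocalSecondLawContactCondLaw
import Summits.AtomisticToContinuum.HydrodynamicLimit.Theorems.JParityClosureLocalSecondLawInitialLayerLLN
import Summits.AtomisticToContinuum.HydrodynamicLimit.Theorems.LocalSecondLaw.Negative.LinearMajorant
import Summits.AtomisticToContinuum.HydrodynamicLimit.Theorems.LocalSecondLaw.Negative.EquilibriumL1

/-!
# Stub B′ (`stub_initialMatching`) of the line `contact-asymmetry-information` for the crux `LocalSecondLaw`
(stmt-AtomisticToContinuum-13081) — part 2: the fields half at `s = 0` (density)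

The part of the initial matching that needs NO entropy convergence: under the crux's `t = 0` tie
`TendstoHydroFieldsAt … 0` (with `ρ(0,·)` continuous and probability local Gibbs laws), the MEAN coarse density
`ρ̄(0, x) = E_ν[ρ_r(Φ₀ z)(x)]` (`rhoBar`) of EVERY bounded tilt `ν = P_N(·|S)`, `P_N(S) ≥ δ″` (`condLaw`), matches the
Euler datum at every centre:

* `contactB_rhoC_uniformLLN` — fixed-`r`, uniform-in-`x` weak LLN for `ρ_r` at `t = 0` against the SMEARED datum
  `∫ b_r(y,x) ρ(0,y) dy` (finite net `gridUp_euclidNet`; `ρ_r` and the smeared datum are `3/(πr⁴)`-Lipschitz in the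
  centre: `initL_fields_lip`, `contactB_smear_lip`; no `r → 0`, hence no `r₀` and no coupling between `r` and the
  bad-event mass — the point that makes the conditioning step below possible in the frame's quantifier order);
* `contactB_rhoBar_condLaw_smeared` — conditioning: off the bad event `B` (law-mass `≤ t·δ″`) the observable is
  `ε/2`-close, `P_N(B|S) ≤ t` (`contactB_condLaw_apply_le_of_floor`), and `0 ≤ ρ_r ≤ 3/(πr³)` everywhere
  (`rhoC_le_const`), so `|ρ̄_ν(0,x) − ∫ b_r ρ(0)| ≤ ε` for ALL `S` of mass `≥ δ″` (`contactB_abs_integral_sub_le`);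
* `contactB_rhoBar_condLaw_lln` — the same against `ρ(0, x)` itself in the frame's order
  `∀ ε ∃ r₀ ∀ r < r₀ ∀ δ″ ∃ N₀ ∀ N ≥ N₀ ∀ S ∀ x` (`r₀` = uniform-continuity scale of `ρ(0,·)`; unit cone mass `initL_coneAvg`).

The momentum/energy analogues (needed by the velocity-entropy identity of B′) require in addition the uniform
integrability of `e_r` under the local Gibbs law (second moments); they are not in this file.

References: H. Spohn, *Large Scale Dynamics of Interacting Particles* (1991), Part I §2.3–§3; C. Kipnis, C. Landim,
*Scaling Limits of Interacting Particle Systems* (1999), Ch. 4 (finite nets and moduli of continuity).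
-/

noncomputable section

open scoped BigOperators Topology Classical MeasureTheory ENNReal InnerProductSpace
open Filter Set MeasureTheory Function
open Literature.MathematicalPhysics.KineticTheory
open Literature.Analysis.FluidPDE
open Summit.AtomisticToContinuum.HydrodynamicLimit.Theorems.LocalSecondLawNegative
open Summit.AtomisticToContinuum.HydrodynamicLimit.Theorems.LocalSecondLawLedger

namespace Summit.AtomisticToContinuum.HydrodynamicLimit.Theorems.LocalSecondLawContact

/-! ## B′ sub-lemmas: the fields half at `s = 0` (uniform LLN at fixed `r`, then conditioning) -/

/-- The cone-smeared datum `x ↦ ∫ b_r(y,x) g(y) dy` of a continuous function with `|g| ≤ R` is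
`3/(πr⁴)·R`-Lipschitz in the centre (minimal-image distance). -/
theorem contactB_smear_lip :
    ∀ {r R : ℝ}, 0 < r → ∀ (g : T3 → ℝ), Continuous g → (∀ y, |g y| ≤ R) → ∀ x x' : T3,
      |(∫ y, cone r y x * g y) - ∫ y, cone r y x' * g y| ≤ 3 / (Real.pi * r ^ 4) * Torus.euclidDist x x' * R := by
  intro r R hr g hgc hg x x'
  have hR : 0 ≤ R := (abs_nonneg _).trans (hg 0)
  have hi : ∀ x₀ : T3, Integrable (fun y => cone r y x₀ * g y) := fun x₀ =>
    integrable_of_continuous_T3 ((contactB_continuous_cone_left r x₀).mul hgc)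
  rw [← integral_sub (hi x) (hi x')]
  have hd0 : 0 ≤ Torus.euclidDist x x' := norm_nonneg _
  have hpt : ∀ y, ‖cone r y x * g y - cone r y x' * g y‖ ≤ 3 / (Real.pi * r ^ 4) * Torus.euclidDist x x' * R := by
    intro y
    rw [Real.norm_eq_abs, ← sub_mul, abs_mul]
    refine mul_le_mul ?_ (hg y) (abs_nonneg _) (by positivity)
    rw [show cone r y x = cone r x y from densMod_cone_comm r x y,
      show cone r y x' = cone r x' y from densMod_cone_comm r x' y]
    exact gridUp_abs_cone_sub_cone_le hr x x' y
  have h := norm_integral_le_of_norm_le_const (μ := (volume : Measure T3)) (Eventually.of_forall hpt)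
  rwa [probReal_univ, mul_one, Real.norm_eq_abs] at h

/-- The cone-smeared datum of a continuous function with `|g| ≤ R` is bounded by `3/(πr³)·R`. -/
theorem contactB_smear_bound :
    ∀ {r R : ℝ}, 0 < r → ∀ (g : T3 → ℝ), (∀ y, |g y| ≤ R) → ∀ x : T3,
      |∫ y, cone r y x * g y| ≤ 3 / (Real.pi * r ^ 3) * R := by
  intro r R hr g hg x
  have hR : 0 ≤ R := (abs_nonneg _).trans (hg 0)
  have hpt : ∀ y, ‖cone r y x * g y‖ ≤ 3 / (Real.pi * r ^ 3) * R := by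
    intro y
    rw [Real.norm_eq_abs, abs_mul, abs_of_nonneg (cone_nonneg hr y x)]
    exact mul_le_mul (contactB_cone_le_const hr y x) (hg y) (abs_nonneg _) (by positivity)
  have h := norm_integral_le_of_norm_le_const (μ := (volume : Measure T3)) (Eventually.of_forall hpt)
  rwa [probReal_univ, mul_one, Real.norm_eq_abs] at h

/-- **Fixed-`r` uniform-in-`x` law of large numbers for the coarse density at `t = 0`, against the SMEARED datum.**
Under the `t = 0` tie with `ρ(0,·)` continuous: for every FIXED `r > 0` and all `ε, δ > 0`, eventually in `N`, off an
event of law-probability `≤ δ`, `|ρ_r(Φ₀z)(x) − ∫ b_r(y,x)ρ(0,y)dy| < ε` at EVERY centre `x` (finite net + the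
`3/(πr⁴)`-Lipschitz dependence of `ρ_r` and of the smeared datum on the centre; no `r → 0`, hence no `r₀`). -/
theorem contactB_rhoC_uniformLLN :
    ∀ {σ : ℝ} {a₀ θ₀ : T3 → ℝ} {u₀ : T3 → V3} {ρ θ : ℝ → T3 → ℝ} {u : ℝ → T3 → V3}, Continuous (ρ 0) →
      ∀ Φ : (N : ℕ) → Flow σ N, TendstoHydroFieldsAt (fun N => localGibbsLaw σ a₀ u₀ θ₀ N (Φ N)) Φ ρ u θ 0 →
      ∀ {r ε δ : ℝ}, 0 < r → 0 < ε → 0 < δ → ∃ N₀ : ℕ, ∀ N : ℕ, N₀ ≤ N →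
        ∃ B : Set (Phase N), localGibbsLaw σ a₀ u₀ θ₀ N (Φ N) B ≤ ENNReal.ofReal δ ∧
          ∀ z, z ∉ B → ∀ x : T3, |rhoC r ((Φ N).flow 0 z) x - ∫ y, cone r y x * ρ 0 y| < ε := by
  intro σ a₀ θ₀ u₀ ρ θ u hρc Φ h0 r ε δ hr hε hδ
  obtain ⟨R, hR0, hR⟩ := exists_forall_abs_le_of_continuous hρc
  have hε4 : 0 < ε / 4 := by positivity
  set L : ℝ := 3 / (Real.pi * r ^ 4)
  have hLpos : 0 < L := by positivity
  set m : ℝ := ε / (4 * (L * (1 + R)))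
  have hmpos : 0 < m := by positivity
  have hmL : L * m ≤ ε / 4 := by
    have h1 : L * m * (1 + R) = ε / 4 := by
      show L * (ε / (4 * (L * (1 + R)))) * (1 + R) = ε / 4
      field_simp
    nlinarith
  have hmLR : L * m * R ≤ ε / 4 := by
    have h1 : L * m * (1 + R) = ε / 4 := by
      show L * (ε / (4 * (L * (1 + R)))) * (1 + R) = ε / 4
      field_simp
    nlinarith
  obtain ⟨Sx, hSx⟩ := gridUp_euclidNet hmpos
  set P : (N : ℕ) → Measure (Phase N) := fun N => localGibbsLaw σ a₀ u₀ θ₀ N (Φ N)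
  set A : (N : ℕ) → T3 → Set (Phase N) := fun N y =>
    {z | ε / 4 < |empiricalDensityField ((Φ N).flow 0 z) (fun x => cone r x y) - ∫ x, cone r x y * ρ 0 x|}
  have hA : ∀ y : T3, Tendsto (fun N => P N (A N y)) atTop (𝓝 0) := fun y =>
    (h0 (fun x => cone r x y) (densMod_continuous_cone r y) (ε / 4) hε4).1
  set F : ℕ → ENNReal := fun N => ∑ y ∈ Sx, P N (A N y)
  have hFT : Tendsto F atTop (𝓝 0) := by
    have hsum := tendsto_finsetSum Sx fun y (_ : y ∈ Sx) => hA y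
    rwa [Finset.sum_const_zero] at hsum
  obtain ⟨N₀, hN₀⟩ := eventually_atTop.1 ((tendsto_order.1 hFT).2 _ (ENNReal.ofReal_pos.2 hδ))
  refine ⟨N₀, fun N hN => ⟨⋃ y ∈ Sx, A N y, ?_, ?_⟩⟩
  · exact ((measure_biUnion_finset_le Sx _).trans (hN₀ N hN).le)
  · intro z hz x
    obtain ⟨y, hy, hxy⟩ := hSx x
    set w := (Φ N).flow 0 z
    have e1 : |rhoC r w y - ∫ x, cone r x y * ρ 0 x| ≤ ε / 4 :=
      not_lt.1 fun h => hz (Set.mem_iUnion.2 ⟨y, Set.mem_iUnion.2 ⟨hy, h⟩⟩)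
    have l1 : |rhoC r w x - rhoC r w y| ≤ ε / 4 :=
      (initL_fields_lip hr w x y).1.trans (le_trans (by nlinarith [mul_le_mul_of_nonneg_left hxy hLpos.le]) hmL)
    have d1 : |(∫ x', cone r x' y * ρ 0 x') - ∫ x', cone r x' x * ρ 0 x'| ≤ ε / 4 := by
      refine (contactB_smear_lip hr (ρ 0) hρc hR y x).trans ?_
      rw [Torus.euclidDist_comm]
      calc L * Torus.euclidDist x y * R ≤ L * m * R := by gcongr
        _ ≤ ε / 4 := hmLR
    have t1 := abs_sub_le (rhoC r w x) (rhoC r w y) (∫ x', cone r x' x * ρ 0 x')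
    have t2 := abs_sub_le (rhoC r w y) (∫ x', cone r x' y * ρ 0 x') (∫ x', cone r x' x * ρ 0 x')
    linarith

/-- **The fields half of B′ (density): under EVERY bounded tilt the mean coarse density at `s = 0` matches the smeared
Euler datum.** Under the `t = 0` tie (probability local Gibbs laws, `ρ(0,·)` continuous): for every fixed `r > 0`,
`ε > 0` and mass floor `δ″ > 0`, eventually in `N`, for EVERY set `S` with `P_N(S) ≥ δ″` and every centre `x`,
`|ρ̄_{P_N(·|S)}(0, x) − ∫ b_r(y,x) ρ(0,y) dy| ≤ ε`.  (Uniform LLN off a bad event `B` of mass `≤ δ″·t`; conditioning: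
`P_N(B|S) ≤ t`; `ρ_r ≤ 3/(πr³)` on `B`.) -/
theorem contactB_rhoBar_condLaw_smeared :
    ∀ {σ : ℝ} {a₀ θ₀ : T3 → ℝ} {u₀ : T3 → V3} {ρ θ : ℝ → T3 → ℝ} {u : ℝ → T3 → V3}, Continuous (ρ 0) →
      ∀ Φ : (N : ℕ) → Flow σ N, (∀ N, IsProbabilityMeasure (localGibbsLaw σ a₀ u₀ θ₀ N (Φ N))) →
      TendstoHydroFieldsAt (fun N => localGibbsLaw σ a₀ u₀ θ₀ N (Φ N)) Φ ρ u θ 0 →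
      ∀ {r ε δ'' : ℝ}, 0 < r → 0 < ε → 0 < δ'' → ∃ N₀ : ℕ, ∀ N : ℕ, N₀ ≤ N →
        ∀ S : Set (Phase N), ENNReal.ofReal δ'' ≤ localGibbsLaw σ a₀ u₀ θ₀ N (Φ N) S →
          ∀ x : T3, |rhoBar r (condLaw (localGibbsLaw σ a₀ u₀ θ₀ N (Φ N)) S) (Φ N) 0 x -
            ∫ y, cone r y x * ρ 0 y| ≤ ε := by
  intro σ a₀ θ₀ u₀ ρ θ u hρc Φ hP h0 r ε δ'' hr hε hδ
  obtain ⟨R, hR0, hR⟩ := exists_forall_abs_le_of_continuous hρc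
  set M : ℝ := 3 / (Real.pi * r ^ 3)
  have hMpos : 0 < M := by positivity
  set t : ℝ := ε / (2 * (M + M * R + 1))
  have htpos : 0 < t := by positivity
  have htM : (M + M * R) * t ≤ ε / 2 := by
    have h1 : (M + M * R + 1) * t = ε / 2 := by
      show (M + M * R + 1) * (ε / (2 * (M + M * R + 1))) = ε / 2
      field_simp
    nlinarith
  obtain ⟨N₀, HN⟩ := contactB_rhoC_uniformLLN hρc Φ h0 hr (half_pos hε) (mul_pos htpos hδ)
  refine ⟨N₀, fun N hN S hS x => ?_⟩
  obtain ⟨B, hB, HB⟩ := HN N hN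
  set μ : Measure (Phase N) := localGibbsLaw σ a₀ u₀ θ₀ N (Φ N)
  haveI : IsProbabilityMeasure μ := hP N
  set ν : Measure (Phase N) := condLaw μ S
  haveI : IsProbabilityMeasure ν := contactB_condLaw_isProbability_of_floor μ S δ'' hδ hS
  set B' : Set (Phase N) := toMeasurable μ B
  have hB' : μ B' ≤ ENNReal.ofReal (t * δ'') := by rwa [measure_toMeasurable]
  have hνB : ν B' ≤ ENNReal.ofReal t :=
    contactB_condLaw_apply_le_of_floor μ S B' t δ'' htpos.le hδ hS hB'
  have hνBr : (ν B').toReal ≤ t := ENNReal.toReal_le_of_le_ofReal htpos.le hνB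
  set c : ℝ := ∫ y, cone r y x * ρ 0 y
  have hc : |c| ≤ M * R := contactB_smear_bound hr (ρ 0) hR x
  set F : Phase N → ℝ := fun z => rhoC r ((Φ N).flow 0 z) x
  have hFm : AEStronglyMeasurable F ν := by
    have hcont : Continuous fun w : Phase N => rhoC r w x := by
      simpa only [Function.comp_def] using
        (continuous_rhoC_uncurry (N := N) r).comp (Continuous.prodMk_left x)
    have hmeas : Measurable F := hcont.measurable.comp ((Φ N).measurable_flow 0)
    exact hmeas.aestronglyMeasurable
  have hFM : ∀ z, |F z| ≤ M := fun z => by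
    rw [abs_of_nonneg (rhoC_nonneg hr _ _)]
    exact rhoC_le_const hr _ _
  have hoff : ∀ z, z ∉ B' → |F z - c| ≤ ε / 2 := fun z hz =>
    (HB z (fun h => hz (subset_toMeasurable μ B h)) x).le
  have key := contactB_abs_integral_sub_le ν F B' M c (ε / 2) hFm hFM (half_pos hε).le hoff
    (measurableSet_toMeasurable μ B)
  have hfin : (M + |c|) * (ν B').toReal ≤ ε / 2 :=
    calc (M + |c|) * (ν B').toReal ≤ (M + M * R) * t := by
          refine mul_le_mul (by linarith) hνBr ENNReal.toReal_nonneg (by positivity)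
      _ ≤ ε / 2 := htM
  show |(∫ z, F z ∂ν) - c| ≤ ε
  linarith

/-- **The fields half of B′ (density), in the frame's quantifier order** (`∀ ε ∃ r₀ ∀ r < r₀ ∀ δ″ ∃ N₀ ∀ N ∀ S ∀ x`):
under the `t = 0` tie, the mean coarse density of EVERY bounded tilt `P_N(·|S)`, `P_N(S) ≥ δ″`, matches the Euler
datum `ρ(0, x)` within `ε` at every centre (`r₀` is the uniform-continuity scale of `ρ(0,·)` at `ε/2`, independent
of `δ″`; smeared matching `contactB_rhoBar_condLaw_smeared` + unit mass of the cone `initL_coneAvg`). -/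
theorem contactB_rhoBar_condLaw_lln :
    ∀ {σ : ℝ} {a₀ θ₀ : T3 → ℝ} {u₀ : T3 → V3} {ρ θ : ℝ → T3 → ℝ} {u : ℝ → T3 → V3}, Continuous (ρ 0) →
      ∀ Φ : (N : ℕ) → Flow σ N, (∀ N, IsProbabilityMeasure (localGibbsLaw σ a₀ u₀ θ₀ N (Φ N))) →
      TendstoHydroFieldsAt (fun N => localGibbsLaw σ a₀ u₀ θ₀ N (Φ N)) Φ ρ u θ 0 →
      ∀ {ε : ℝ}, 0 < ε → ∃ r₀ : ℝ, 0 < r₀ ∧ ∀ r : ℝ, 0 < r → r < r₀ → ∀ δ'' : ℝ, 0 < δ'' →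
        ∃ N₀ : ℕ, ∀ N : ℕ, N₀ ≤ N → ∀ S : Set (Phase N), ENNReal.ofReal δ'' ≤ localGibbsLaw σ a₀ u₀ θ₀ N (Φ N) S →
          ∀ x : T3, |rhoBar r (condLaw (localGibbsLaw σ a₀ u₀ θ₀ N (Φ N)) S) (Φ N) 0 x - ρ 0 x| ≤ ε := by
  intro σ a₀ θ₀ u₀ ρ θ u hρc Φ hP h0 ε hε
  obtain ⟨δ₁, hδ₁, H1⟩ := initL_unifCont hρc (half_pos hε)
  refine ⟨min δ₁ (1 / 2), lt_min hδ₁ one_half_pos, fun r hr hrr₀ δ'' hδ => ?_⟩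
  have hrδ : r < δ₁ := hrr₀.trans_le (min_le_left _ _)
  have hr2 : r ≤ 1 / 2 := (hrr₀.trans_le (min_le_right _ _)).le
  obtain ⟨N₀, HN⟩ := contactB_rhoBar_condLaw_smeared hρc Φ hP h0 hr (half_pos hε) hδ
  refine ⟨N₀, fun N hN S hS x => ?_⟩
  have h1 := HN N hN S hS x
  have h2 : |(∫ y, cone r y x * ρ 0 y) - ρ 0 x| ≤ ε / 2 := by
    have h := initL_coneAvg hρc hr hr2 x fun y hy => (H1 y x (hy.trans hrδ)).le
    simpa only [smul_eq_mul, Real.norm_eq_abs] using h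
  have t := abs_sub_le (rhoBar r (condLaw (localGibbsLaw σ a₀ u₀ θ₀ N (Φ N)) S) (Φ N) 0 x)
    (∫ y, cone r y x * ρ 0 y) (ρ 0 x)
  linarith

end Summit.AtomisticToContinuum.HydrodynamicLimit.Theorems.LocalSecondLawContact

end
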